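import Mathlib.Analysis.SpecialFunctions.Pow.Deriv
import Mathlib.Analysis.SpecialFunctions.ImproperIntegrals
import Mathlib.MeasureTheory.Integral.IntegralEqImproper
import Mathlib.Analysis.SpecialFunctions.Integrals.Basic
import HarnessLib

/-!
# Nicolas's integrals `F_z(x) = ∫_x^∞ t^{z−2}(1/log t + 1/log² t) dt` (Nicolas 2012, Lemma 2.2)

Topic: `Literature/NumberTheory/LFunctions`. THEOREMS (pure calculus, everything proved): Lemma 2.2
of J.-L. Nicolas, *Small values of the Euler function and the Riemann hypothesis*, Acta Arith. 155
(2012) (arXiv:1202.0729), the elementary estimates for the integrals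

  `F_z(x) = ∫_x^∞ t^{z−2} (1/log t + 1/log² t) dt`   (`Re z < 1`, `x > 1`; Nicolas (1.17))

through which the sum over the zeros of `ζ` enters his RH-explicit Mertens bound (Lemma 2.5:
`J(x) = −∑_ρ (1/ρ) F_ρ(x) − J₁(x)`; the named fact `Nicolas2012_logf_lower_sharp` of
`NicolasMertensRH.lean`). As printed:

* (2.2) `F_z(x) = x^{z−1}/((1−z) log x) + r_z(x)`, `r_z(x) = ∫_x^∞ −z t^{z−2}/((1−z) log² t) dt`
  (`Fz_eq`);
* the partial integration `r_z(x) = −(z/(1−z)) (x^{z−1}/((1−z) log² x) + ∫_x^∞ 2t^{z−2}/((z−1) log³ t) dt)`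
  (display (2.6), `rz_eq`);
* (2.3) for `Re z = 1/2`: `|r_z(x)| ≤ (1 + 4/log x)/(|1−z| √x log² x)` (`norm_rz_le`);
* (2.4) `2/(√x log x) − 2/(√x log² x) ≤ F_{1/2}(x) ≤ 2/(√x log x) − 2/(√x log² x) + 8/(√x log³ x)`
  (`Fhalf_ge`, `Fhalf_le`);
* (2.5) `0 ≤ F_{1/3}(x) ≤ 3/(2 x^{2/3} log x)` (`Fthird_nonneg`, `Fthird_le`).

Proof: "taking the derivative" — `t^{z−2}(1/log t + 1/log²t) = −(d/dt) [t^{z−1}/((1−z) log t)] − z t^{z−2}/((1−z) log² t)`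
and `t^{z−2}/log² t = (d/dt)[t^{z−1}/((z−1) log² t)] + 2t^{z−2}/((z−1) log³ t)`, integrated over
`(x, ∞)` (Mathlib's `integral_Ioi_of_hasDerivAt_of_tendsto`), the boundary terms at `∞` vanishing
since `Re z < 1`.

## References

* J.-L. Nicolas, Acta Arith. 155 (2012), 311–321 (arXiv:1202.0729), (1.17), Lemma 2.2,
  (2.2)–(2.6). [Nicolas2012]
-/

noncomputable section

open Complex Filter Set MeasureTheory Topology
open scoped Real

namespace Literature.NumberTheory.LFunctions

namespace NicolasFz

/-! ### The weight and the integrands -/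

/-- Nicolas's weight `1/log t + 1/log² t` (so that `(1/log t + 1/log²t)/t² = −(d/dt)(1/(t log t))`).
[cite: Nicolas2012, (1.15)–(1.17)] -/
def wt (t : ℝ) : ℝ := 1 / Real.log t + 1 / Real.log t ^ 2

/-- **`F_z(x) = ∫_x^∞ t^{z−2}(1/log t + 1/log² t) dt`** (Nicolas 2012, (1.17); `Re z < 1`).
[cite: Nicolas2012, (1.17)] -/
def Fz (z : ℂ) (x : ℝ) : ℂ := ∫ t in Ioi x, (t : ℂ) ^ (z - 2) * (wt t : ℂ)

/-- **`r_z(x) = ∫_x^∞ −z t^{z−2}/((1−z) log² t) dt`** (Nicolas 2012, (2.2)). [cite: Nicolas2012, Lemma 2.2 (2.2)] -/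
def rz (z : ℂ) (x : ℝ) : ℂ := ∫ t in Ioi x, -z / (1 - z) * ((t : ℂ) ^ (z - 2) * ((1 / Real.log t ^ 2 : ℝ) : ℂ))

variable {z : ℂ} {x : ℝ}

/-- `1 − z ≠ 0` for `Re z < 1`. [folklore] -/
theorem one_sub_ne_zero (hz : z.re < 1) : 1 - z ≠ 0 := by
  intro h; have := congrArg Complex.re h; simp at this; linarith

/-! ### Integrability on `(x, ∞)` -/

/-- On `(x, ∞)`, `x > 1`, a continuous real function of `log t` times `t^{z−2}` is integrable when it
is bounded: the model case `‖t^{z−2} g(t)‖ ≤ M t^{Re z − 2}`, `Re z < 1`. [folklore] -/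
theorem integrableOn_cpow_mul (hz : z.re < 1) (hx : 1 < x) {g : ℝ → ℝ} {M : ℝ}
    (hg : ContinuousOn g (Ici x)) (hM : ∀ t, x ≤ t → |g t| ≤ M) :
    IntegrableOn (fun t : ℝ ↦ (t : ℂ) ^ (z - 2) * (g t : ℂ)) (Ioi x) := by
  have hx0 : 0 < x := by linarith
  have hint : IntegrableOn (fun t : ℝ ↦ M * t ^ (z.re - 2)) (Ioi x) :=
    (integrableOn_Ioi_rpow_of_lt (by linarith) hx0).const_mul M
  refine hint.mono' ?_ ?_
  · refine ContinuousOn.aestronglyMeasurable ?_ measurableSet_Ioi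
    refine ContinuousOn.mul ?_ (Complex.continuous_ofReal.comp_continuousOn (hg.mono Ioi_subset_Ici_self))
    exact ContinuousOn.cpow_const (Complex.continuous_ofReal.continuousOn) fun t ht ↦
      Or.inl (by simp; linarith [mem_Ioi.1 ht])
  · refine (ae_restrict_iff' measurableSet_Ioi).2 (ae_of_all _ fun t ht ↦ ?_)
    have ht0 : 0 < t := hx0.trans ht
    rw [norm_mul, Complex.norm_cpow_eq_rpow_re_of_pos ht0 _, Complex.norm_real, Real.norm_eq_abs, sub_re,
      show (2 : ℂ).re = 2 by simp, mul_comm]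
    exact mul_le_mul_of_nonneg_right (hM t ht.le) (by positivity)

/-- `1/log t ^ k` is continuous on `[x, ∞)` for `x > 1` and bounded by `1/log x ^ k`. [folklore] -/
theorem continuousOn_inv_log_pow (hx : 1 < x) (k : ℕ) :
    ContinuousOn (fun t : ℝ ↦ 1 / Real.log t ^ k) (Ici x) := by
  refine ContinuousOn.div continuousOn_const ((Real.continuousOn_log.mono ?_).pow k) fun t ht ↦ ?_
  · intro t ht; simp; linarith [mem_Ici.1 ht]
  · exact pow_ne_zero _ (Real.log_pos (by linarith [mem_Ici.1 ht])).ne'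

/-- `1/log t ^ k ≤ 1/log x ^ k` for `t ≥ x > 1`. [folklore] -/
theorem inv_log_pow_le (hx : 1 < x) (k : ℕ) {t : ℝ} (ht : x ≤ t) :
    |1 / Real.log t ^ k| ≤ 1 / Real.log x ^ k := by
  have hlx : 0 < Real.log x := Real.log_pos hx
  have hlt : Real.log x ≤ Real.log t := Real.log_le_log (by linarith) ht
  have hlt0 : 0 < Real.log t := hlx.trans_le hlt
  rw [abs_of_nonneg (div_nonneg zero_le_one (pow_nonneg hlt0.le k))]
  exact one_div_le_one_div_of_le (pow_pos hlx k) (pow_le_pow_left₀ hlx.le hlt k)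

/-- The integrand of `F_z` is integrable on `(x, ∞)` (`Re z < 1`, `x > 1`). [folklore] -/
theorem integrableOn_Fz (hz : z.re < 1) (hx : 1 < x) :
    IntegrableOn (fun t : ℝ ↦ (t : ℂ) ^ (z - 2) * (wt t : ℂ)) (Ioi x) := by
  refine integrableOn_cpow_mul hz hx (M := 1 / Real.log x + 1 / Real.log x ^ 2)
    ((continuousOn_inv_log_pow hx 1).add (continuousOn_inv_log_pow hx 2) |>.congr fun t _ ↦ by
      simp [wt]) fun t ht ↦ ?_
  have h1 := inv_log_pow_le hx 1 ht
  have h2 := inv_log_pow_le hx 2 ht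
  rw [pow_one, pow_one] at h1
  calc |wt t| ≤ |1 / Real.log t| + |1 / Real.log t ^ 2| := abs_add_le _ _
    _ ≤ _ := add_le_add h1 h2

/-- The integrand `t^{z−2}/log^k t` is integrable on `(x, ∞)` (`Re z < 1`, `x > 1`). [folklore] -/
theorem integrableOn_cpow_div_log_pow (hz : z.re < 1) (hx : 1 < x) (k : ℕ) :
    IntegrableOn (fun t : ℝ ↦ (t : ℂ) ^ (z - 2) * ((1 / Real.log t ^ k : ℝ) : ℂ)) (Ioi x) :=
  integrableOn_cpow_mul hz hx (continuousOn_inv_log_pow hx k) fun _ ht ↦ inv_log_pow_le hx k ht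

/-! ### The two antiderivatives -/

/-- `t^{z−2} · t = t^{z−1}` for `t > 0`. [folklore] -/
theorem cpow_sub_two_mul {t : ℝ} (ht : 0 < t) (z : ℂ) :
    (t : ℂ) ^ (z - 2) * t = (t : ℂ) ^ (z - 1) := by
  have ht0 : (t : ℂ) ≠ 0 := by exact_mod_cast ht.ne'
  rw [show z - 1 = (z - 2) + 1 by ring, Complex.cpow_add _ _ ht0, Complex.cpow_one]

/-- **First antiderivative**: for `t > 1`,
`(d/dt) [t^{z−1}/((1−z) log t)] = −t^{z−2}/log t − t^{z−2}/((1−z) log² t)`. [cite: Nicolas2012, Lemma 2.2 (proof: "taking the derivative")] -/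
theorem hasDerivAt_anti₁ (hz : z.re < 1) {t : ℝ} (ht : 1 < t) :
    HasDerivAt (fun u : ℝ ↦ (u : ℂ) ^ (z - 1) * ((1 - z) * (Real.log u : ℂ))⁻¹)
      (-(t : ℂ) ^ (z - 2) * ((1 / Real.log t : ℝ) : ℂ) -
        (t : ℂ) ^ (z - 2) * ((1 / Real.log t ^ 2 : ℝ) : ℂ) / (1 - z)) t := by
  have ht0 : t ≠ 0 := by linarith
  have ht0' : (0 : ℝ) < t := by linarith
  have hlog : Real.log t ≠ 0 := (Real.log_pos ht).ne'
  have h1z : 1 - z ≠ 0 := one_sub_ne_zero hz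
  have hz1 : z - 1 ≠ 0 := fun h ↦ h1z (by linear_combination -h)
  have hd1 : HasDerivAt (fun u : ℝ ↦ (u : ℂ) ^ (z - 1)) ((z - 1) * (t : ℂ) ^ (z - 1 - 1)) t :=
    hasDerivAt_ofReal_cpow_const ht0 hz1
  have hl : HasDerivAt (fun u : ℝ ↦ ((Real.log u : ℝ) : ℂ)) ((t⁻¹ : ℝ) : ℂ) t :=
    (Real.hasDerivAt_log ht0).ofReal_comp
  have hden : HasDerivAt (fun u : ℝ ↦ (1 - z) * ((Real.log u : ℝ) : ℂ)) ((1 - z) * ((t⁻¹ : ℝ) : ℂ)) t :=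
    hl.const_mul _
  have hne : (1 - z) * ((Real.log t : ℝ) : ℂ) ≠ 0 := mul_ne_zero h1z (by exact_mod_cast hlog)
  have hd2 := hden.inv hne
  refine (hd1.mul hd2).congr_deriv ?_
  simp only [Pi.inv_apply]
  rw [show z - 1 - 1 = z - 2 by ring]
  have hlogC : ((Real.log t : ℝ) : ℂ) ≠ 0 := by exact_mod_cast hlog
  have htC : (t : ℂ) ≠ 0 := by exact_mod_cast ht0
  rw [← cpow_sub_two_mul ht0' z]
  push_cast
  field_simp
  ring

/-- **Second antiderivative**: for `t > 1`,
`(d/dt) [t^{z−1}/((z−1) log² t)] = t^{z−2}/log² t − 2 t^{z−2}/((z−1) log³ t)`. [cite: Nicolas2012, Lemma 2.2 (proof, (2.6))] -/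
theorem hasDerivAt_anti₂ (hz : z.re < 1) {t : ℝ} (ht : 1 < t) :
    HasDerivAt (fun u : ℝ ↦ (u : ℂ) ^ (z - 1) * ((z - 1) * ((Real.log u : ℝ) : ℂ) ^ 2)⁻¹)
      ((t : ℂ) ^ (z - 2) * ((1 / Real.log t ^ 2 : ℝ) : ℂ) -
        2 * ((t : ℂ) ^ (z - 2) * ((1 / Real.log t ^ 3 : ℝ) : ℂ)) / (z - 1)) t := by
  have ht0 : t ≠ 0 := by linarith
  have ht0' : (0 : ℝ) < t := by linarith
  have hlog : Real.log t ≠ 0 := (Real.log_pos ht).ne'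
  have h1z : 1 - z ≠ 0 := one_sub_ne_zero hz
  have hz1 : z - 1 ≠ 0 := fun h ↦ h1z (by linear_combination -h)
  have hd1 : HasDerivAt (fun u : ℝ ↦ (u : ℂ) ^ (z - 1)) ((z - 1) * (t : ℂ) ^ (z - 1 - 1)) t :=
    hasDerivAt_ofReal_cpow_const ht0 hz1
  have hl : HasDerivAt (fun u : ℝ ↦ ((Real.log u : ℝ) : ℂ)) ((t⁻¹ : ℝ) : ℂ) t :=
    (Real.hasDerivAt_log ht0).ofReal_comp
  have hl2 := hl.pow 2
  have hden : HasDerivAt (fun u : ℝ ↦ (z - 1) * ((Real.log u : ℝ) : ℂ) ^ 2)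
      ((z - 1) * ((2 : ℕ) * ((Real.log t : ℝ) : ℂ) ^ (2 - 1) * ((t⁻¹ : ℝ) : ℂ))) t := hl2.const_mul _
  have hne : (z - 1) * ((Real.log t : ℝ) : ℂ) ^ 2 ≠ 0 :=
    mul_ne_zero hz1 (pow_ne_zero _ (by exact_mod_cast hlog))
  have hd2 := hden.inv hne
  refine (hd1.mul hd2).congr_deriv ?_
  simp only [Pi.inv_apply]
  rw [show z - 1 - 1 = z - 2 by ring]
  have hlogC : ((Real.log t : ℝ) : ℂ) ≠ 0 := by exact_mod_cast hlog
  have htC : (t : ℂ) ≠ 0 := by exact_mod_cast ht0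
  rw [← cpow_sub_two_mul ht0' z]
  push_cast
  field_simp
  ring

/-- The boundary terms vanish at infinity: `t^{z−1} c/log^k t → 0` (`Re z < 1`), for any constant `c`
and `k : ℕ`. [folklore] -/
theorem tendsto_cpow_mul_inv_log_pow (hz : z.re < 1) (c : ℂ) (k : ℕ) :
    Tendsto (fun t : ℝ ↦ (t : ℂ) ^ (z - 1) * (c / ((Real.log t : ℂ)) ^ k)) atTop (𝓝 0) := by
  rw [tendsto_zero_iff_norm_tendsto_zero]
  -- `‖·‖ ≤ ‖c‖/(log 2)^k · t^{Re z - 1}` for `t ≥ 2`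
  have hlim : Tendsto (fun t : ℝ ↦ ‖c‖ / Real.log 2 ^ k * t ^ (z.re - 1)) atTop (𝓝 0) := by
    have := tendsto_rpow_neg_atTop (y := 1 - z.re) (by linarith)
    have h2 : Tendsto (fun t : ℝ ↦ t ^ (z.re - 1)) atTop (𝓝 0) := by
      refine this.congr fun t ↦ ?_; congr 1; ring
    simpa using h2.const_mul (‖c‖ / Real.log 2 ^ k)
  refine squeeze_zero' (Eventually.of_forall fun t ↦ norm_nonneg _) ?_ hlim
  filter_upwards [eventually_ge_atTop 2] with t ht
  have ht0 : 0 < t := by linarith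
  have hlog2 : 0 < Real.log 2 := Real.log_pos one_lt_two
  have hlogt : Real.log 2 ≤ Real.log t := Real.log_le_log two_pos ht
  rw [norm_mul, Complex.norm_cpow_eq_rpow_re_of_pos ht0 _, norm_div, norm_pow, Complex.norm_real, Real.norm_eq_abs,
    abs_of_pos (hlog2.trans_le hlogt), sub_re, one_re, mul_comm]
  refine mul_le_mul_of_nonneg_right ?_ (by positivity)
  exact div_le_div_of_nonneg_left (norm_nonneg _) (pow_pos hlog2 k) (pow_le_pow_left₀ hlog2.le hlogt k)

/-! ### Lemma 2.2: the identities -/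

/-- **Nicolas 2012, (2.2)**: for `Re z < 1`, `x > 1`, `F_z(x) = x^{z−1}/((1−z) log x) + r_z(x)`.
[cite: Nicolas2012, Lemma 2.2 (2.2)] -/
theorem Fz_eq (hz : z.re < 1) (hx : 1 < x) :
    Fz z x = (x : ℂ) ^ (z - 1) / ((1 - z) * Real.log x) + rz z x := by
  have h1z : 1 - z ≠ 0 := one_sub_ne_zero hz
  have hx0 : 0 < x := by linarith
  have hlxC : ((Real.log x : ℝ) : ℂ) ≠ 0 := by exact_mod_cast (Real.log_pos hx).ne'
  set A : ℝ → ℂ := fun u ↦ (u : ℂ) ^ (z - 1) * ((1 - z) * (Real.log u : ℂ))⁻¹ with hA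
  set A' : ℝ → ℂ := fun t ↦ -(t : ℂ) ^ (z - 2) * ((1 / Real.log t : ℝ) : ℂ) -
    (t : ℂ) ^ (z - 2) * ((1 / Real.log t ^ 2 : ℝ) : ℂ) / (1 - z) with hA'
  have hderiv : ∀ t ∈ Ici x, HasDerivAt A (A' t) t := fun t ht ↦ hasDerivAt_anti₁ hz (hx.trans_le ht)
  have hint₁ := integrableOn_cpow_div_log_pow hz hx 1
  have hint₂ := integrableOn_cpow_div_log_pow hz hx 2
  have hA'int : IntegrableOn A' (Ioi x) := by
    have := (hint₁.neg).sub (hint₂.div_const (1 - z))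
    refine this.congr_fun (fun t _ ↦ ?_) measurableSet_Ioi
    simp only [hA', pow_one, Pi.neg_apply, Pi.sub_apply]
    ring
  have hlim : Tendsto A atTop (𝓝 0) := by
    have := tendsto_cpow_mul_inv_log_pow hz (1 - z)⁻¹ 1
    refine this.congr' ?_
    filter_upwards [eventually_gt_atTop 1] with t ht
    have hlog : ((Real.log t : ℝ) : ℂ) ≠ 0 := by exact_mod_cast (Real.log_pos ht).ne'
    simp only [hA, pow_one]
    field_simp
  have hFTC := integral_Ioi_of_hasDerivAt_of_tendsto' hderiv hA'int hlim
  have hsplit : ∀ t ∈ Ioi x, (t : ℂ) ^ (z - 2) * (wt t : ℂ) =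
      -A' t + (-z / (1 - z) * ((t : ℂ) ^ (z - 2) * ((1 / Real.log t ^ 2 : ℝ) : ℂ))) := by
    intro t ht
    have hlog : Real.log t ≠ 0 := (Real.log_pos (hx.trans ht)).ne'
    have hlogC : ((Real.log t : ℝ) : ℂ) ≠ 0 := by exact_mod_cast hlog
    simp only [hA', wt]
    push_cast
    field_simp
    ring
  rw [Fz, setIntegral_congr_fun measurableSet_Ioi hsplit,
    integral_add (f := fun t ↦ -A' t) (by exact hA'int.neg) (hint₂.const_mul _), integral_neg, hFTC, rz]
  simp only [hA, zero_sub, neg_neg]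
  field_simp

/-- **Nicolas 2012, (2.6)**: `r_z(x) = −(z/(1−z)) (x^{z−1}/((1−z) log² x) + ∫_x^∞ 2t^{z−2}/((z−1) log³t) dt)`.
[cite: Nicolas2012, Lemma 2.2 (2.6)] -/
theorem rz_eq (hz : z.re < 1) (hx : 1 < x) :
    rz z x = -(z / (1 - z)) * ((x : ℂ) ^ (z - 1) / ((1 - z) * (Real.log x : ℂ) ^ 2) +
      ∫ t in Ioi x, 2 / (z - 1) * ((t : ℂ) ^ (z - 2) * ((1 / Real.log t ^ 3 : ℝ) : ℂ))) := by
  have h1z : 1 - z ≠ 0 := one_sub_ne_zero hz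
  have hz1 : z - 1 ≠ 0 := fun h ↦ h1z (by linear_combination -h)
  have hlxC : ((Real.log x : ℝ) : ℂ) ≠ 0 := by exact_mod_cast (Real.log_pos hx).ne'
  set B : ℝ → ℂ := fun u ↦ (u : ℂ) ^ (z - 1) * ((z - 1) * ((Real.log u : ℝ) : ℂ) ^ 2)⁻¹ with hB
  set B' : ℝ → ℂ := fun t ↦ (t : ℂ) ^ (z - 2) * ((1 / Real.log t ^ 2 : ℝ) : ℂ) -
    2 * ((t : ℂ) ^ (z - 2) * ((1 / Real.log t ^ 3 : ℝ) : ℂ)) / (z - 1) with hB'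
  have hderiv : ∀ t ∈ Ici x, HasDerivAt B (B' t) t := fun t ht ↦ hasDerivAt_anti₂ hz (hx.trans_le ht)
  have hint₂ := integrableOn_cpow_div_log_pow hz hx 2
  have hint₃ := integrableOn_cpow_div_log_pow hz hx 3
  have hB'int : IntegrableOn B' (Ioi x) := by
    have := hint₂.sub ((hint₃.const_mul 2).div_const (z - 1))
    refine this.congr_fun (fun t _ ↦ ?_) measurableSet_Ioi
    simp only [hB', Pi.sub_apply]
  have hlim : Tendsto B atTop (𝓝 0) := by
    have := tendsto_cpow_mul_inv_log_pow hz (z - 1)⁻¹ 2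
    refine this.congr' ?_
    filter_upwards [eventually_gt_atTop 1] with t ht
    have hlog : ((Real.log t : ℝ) : ℂ) ≠ 0 := by exact_mod_cast (Real.log_pos ht).ne'
    simp only [hB]
    field_simp
  have hFTC := integral_Ioi_of_hasDerivAt_of_tendsto' hderiv hB'int hlim
  have hkey : ∫ t in Ioi x, (t : ℂ) ^ (z - 2) * ((1 / Real.log t ^ 2 : ℝ) : ℂ) =
      -B x + ∫ t in Ioi x, 2 / (z - 1) * ((t : ℂ) ^ (z - 2) * ((1 / Real.log t ^ 3 : ℝ) : ℂ)) := by
    have hsplit : ∀ t ∈ Ioi x, (t : ℂ) ^ (z - 2) * ((1 / Real.log t ^ 2 : ℝ) : ℂ) =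
        B' t + 2 / (z - 1) * ((t : ℂ) ^ (z - 2) * ((1 / Real.log t ^ 3 : ℝ) : ℂ)) := by
      intro t _
      simp only [hB']
      field_simp
      ring
    rw [setIntegral_congr_fun measurableSet_Ioi hsplit,
      integral_add (f := fun t ↦ B' t) hB'int (hint₃.const_mul _), hFTC]
    ring
  rw [rz, integral_const_mul, hkey]
  simp only [hB]
  field_simp
  ring

/-! ### Lemma 2.2: the bounds -/

/-- `‖∫_x^∞ c t^{z−2}/log^k t dt‖ ≤ ‖c‖ ∫_x^∞ t^{Re z − 2} dt/log^k x = ‖c‖ x^{Re z−1}/((1 − Re z) log^k x)`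
(`Re z < 1`, `x > 1`). [folklore] -/
theorem norm_integral_cpow_div_log_pow_le (hz : z.re < 1) (hx : 1 < x) (c : ℂ) (k : ℕ) :
    ‖∫ t in Ioi x, c * ((t : ℂ) ^ (z - 2) * ((1 / Real.log t ^ k : ℝ) : ℂ))‖ ≤
      ‖c‖ * (x ^ (z.re - 1) / ((1 - z.re) * Real.log x ^ k)) := by
  have hx0 : 0 < x := by linarith
  have hlx : 0 < Real.log x := Real.log_pos hx
  have hint := integrableOn_cpow_div_log_pow hz hx k
  have hrpow : IntegrableOn (fun t : ℝ ↦ t ^ (z.re - 2)) (Ioi x) :=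
    integrableOn_Ioi_rpow_of_lt (by linarith) hx0
  calc ‖∫ t in Ioi x, c * ((t : ℂ) ^ (z - 2) * ((1 / Real.log t ^ k : ℝ) : ℂ))‖
      ≤ ∫ t in Ioi x, ‖c * ((t : ℂ) ^ (z - 2) * ((1 / Real.log t ^ k : ℝ) : ℂ))‖ :=
        norm_integral_le_integral_norm _
    _ ≤ ∫ t in Ioi x, ‖c‖ / Real.log x ^ k * t ^ (z.re - 2) := by
        refine setIntegral_mono_on (hint.const_mul c).norm (hrpow.const_mul _) measurableSet_Ioi
          fun t ht ↦ ?_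
        have ht0 : 0 < t := hx0.trans ht
        rw [norm_mul, norm_mul, Complex.norm_cpow_eq_rpow_re_of_pos ht0 _, Complex.norm_real, Real.norm_eq_abs, sub_re,
          show (2 : ℂ).re = 2 by simp]
        have h := inv_log_pow_le hx k ht.le
        calc ‖c‖ * (t ^ (z.re - 2) * |1 / Real.log t ^ k|) ≤ ‖c‖ * (t ^ (z.re - 2) * (1 / Real.log x ^ k)) := by
              gcongr
          _ = ‖c‖ / Real.log x ^ k * t ^ (z.re - 2) := by ring
    _ = ‖c‖ / Real.log x ^ k * (-x ^ (z.re - 2 + 1) / (z.re - 2 + 1)) := by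
        rw [integral_const_mul, integral_Ioi_rpow_of_lt (by linarith) hx0]
    _ = ‖c‖ * (x ^ (z.re - 1) / ((1 - z.re) * Real.log x ^ k)) := by
        rw [show z.re - 2 + 1 = z.re - 1 by ring]
        have : (1 - z.re) ≠ 0 := by linarith
        have : (z.re - 1) ≠ 0 := by linarith
        field_simp
        ring

/-- On the critical line `1 − z = conj z`, so `‖z/(1−z)‖ = 1`. [cite: Nicolas2012, Lemma 2.2 (proof: "1 − z = z̄")] -/
theorem norm_div_one_sub_eq_one (hz : z.re = 1 / 2) : ‖z / (1 - z)‖ = 1 := by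
  have h1 : 1 - z = starRingEnd ℂ z := by
    apply Complex.ext
    · simp [hz]; norm_num
    · simp
  have hz0 : z ≠ 0 := fun h ↦ by rw [h] at hz; simp at hz
  rw [h1, norm_div, Complex.norm_conj, div_self (norm_ne_zero_iff.2 hz0)]

/-- **Nicolas 2012, (2.3)**: for `Re z = 1/2` and `x > 1`,
`|r_z(x)| ≤ (1 + 4/log x)/(|1−z| √x log² x)`. [cite: Nicolas2012, Lemma 2.2 (2.3)] -/
theorem norm_rz_le (hz : z.re = 1 / 2) (hx : 1 < x) :
    ‖rz z x‖ ≤ (1 + 4 / Real.log x) / (‖1 - z‖ * Real.sqrt x * Real.log x ^ 2) := by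
  have hzlt : z.re < 1 := by rw [hz]; norm_num
  have hx0 : 0 < x := by linarith
  have hlx : 0 < Real.log x := Real.log_pos hx
  have h1z : 1 - z ≠ 0 := one_sub_ne_zero hzlt
  have hn1z : 0 < ‖1 - z‖ := norm_pos_iff.2 h1z
  have hzz : ‖z / (1 - z)‖ = 1 := norm_div_one_sub_eq_one hz
  rw [rz_eq hzlt hx, norm_mul, norm_neg, hzz, one_mul]
  -- the two terms
  have hsqrt : x ^ (z.re - 1) = 1 / Real.sqrt x := by
    rw [hz, show (1 / 2 - 1 : ℝ) = -(1 / 2) by norm_num, Real.rpow_neg hx0.le, Real.sqrt_eq_rpow,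
      inv_eq_one_div]
  have t1 : ‖(x : ℂ) ^ (z - 1) / ((1 - z) * (Real.log x : ℂ) ^ 2)‖ =
      1 / (‖1 - z‖ * Real.sqrt x * Real.log x ^ 2) := by
    rw [norm_div, Complex.norm_cpow_eq_rpow_re_of_pos hx0 _, sub_re, one_re, hsqrt, norm_mul, norm_pow, Complex.norm_real,
      Real.norm_eq_abs, abs_of_pos hlx]
    field_simp
  have t2 : ‖∫ t in Ioi x, 2 / (z - 1) * ((t : ℂ) ^ (z - 2) * ((1 / Real.log t ^ 3 : ℝ) : ℂ))‖ ≤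
      4 / (‖1 - z‖ * Real.sqrt x * Real.log x ^ 3) := by
    refine (norm_integral_cpow_div_log_pow_le hzlt hx _ 3).trans (le_of_eq ?_)
    rw [norm_div, Complex.norm_two, show ‖z - 1‖ = ‖1 - z‖ by rw [← norm_neg]; congr 1; ring, hsqrt, hz]
    field_simp
    norm_num
  calc _ ≤ ‖(x : ℂ) ^ (z - 1) / ((1 - z) * (Real.log x : ℂ) ^ 2)‖ +
        ‖∫ t in Ioi x, 2 / (z - 1) * ((t : ℂ) ^ (z - 2) * ((1 / Real.log t ^ 3 : ℝ) : ℂ))‖ :=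
        norm_add_le _ _
    _ ≤ 1 / (‖1 - z‖ * Real.sqrt x * Real.log x ^ 2) + 4 / (‖1 - z‖ * Real.sqrt x * Real.log x ^ 3) := by
        rw [t1]; gcongr
    _ = (1 + 4 / Real.log x) / (‖1 - z‖ * Real.sqrt x * Real.log x ^ 2) := by
        field_simp

/-! ### Real arguments `z = a ∈ (−∞, 1)`: `F_a(x)` is a real number -/

/-- For real `a`, `t^{a−2}·(1/log t + 1/log²t)` on `(x,∞)` is the real function cast to `ℂ`. [folklore] -/
theorem integrand_ofReal {a t : ℝ} (ht : 0 < t) :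
    (t : ℂ) ^ ((a : ℂ) - 2) * (wt t : ℂ) = ((t ^ (a - 2) * wt t : ℝ) : ℂ) := by
  rw [show ((a : ℂ) - 2) = ((a - 2 : ℝ) : ℂ) by push_cast; ring, ← Complex.ofReal_cpow ht.le]
  push_cast
  ring

/-- For real `a < 1` and `x > 1`, `F_a(x) = ∫_x^∞ t^{a−2}(1/log t + 1/log²t) dt` as a real integral.
[cite: Nicolas2012, (1.17)] -/
theorem Fz_ofReal {a : ℝ} (hx : 1 < x) :
    Fz a x = ((∫ t in Ioi x, t ^ (a - 2) * wt t : ℝ) : ℂ) := by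
  rw [Fz, ← integral_complex_ofReal]
  refine setIntegral_congr_fun measurableSet_Ioi fun t ht ↦ ?_
  exact integrand_ofReal (by linarith [mem_Ioi.1 ht])

/-- The real integrand is non-negative on `(x, ∞)`, `x > 1`. [folklore] -/
theorem integrand_nonneg {a t : ℝ} (ht : 1 < t) : 0 ≤ t ^ (a - 2) * wt t := by
  have : 0 < Real.log t := Real.log_pos ht
  have : 0 < t := by linarith
  unfold wt
  positivity

/-- `0 ≤ F_a(x)` for every real `a` and `x > 1` (the integrand is non-negative).
[cite: Nicolas2012, Lemma 2.2 (2.5)] -/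
theorem Fz_re_nonneg {a : ℝ} (hx : 1 < x) : 0 ≤ (Fz a x).re := by
  rw [Fz_ofReal hx, Complex.ofReal_re]
  exact setIntegral_nonneg measurableSet_Ioi fun t ht ↦ integrand_nonneg (hx.trans ht)

/-- **Nicolas 2012, (2.5), lower half**: `0 ≤ F_{1/3}(x)` (`x > 1`). [cite: Nicolas2012, Lemma 2.2 (2.5)] -/
theorem Fthird_nonneg (hx : 1 < x) : 0 ≤ (Fz (1 / 3 : ℝ) x).re := Fz_re_nonneg hx

/-- **Nicolas 2012, (2.5), upper half**: `F_{1/3}(x) ≤ 3/(2 x^{2/3} log x)` for `x > 1` (`r_{1/3} ≤ 0`).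
[cite: Nicolas2012, Lemma 2.2 (2.5)] -/
theorem Fthird_le (hx : 1 < x) :
    (Fz (1 / 3 : ℝ) x).re ≤ 3 / (2 * x ^ (2 / 3 : ℝ) * Real.log x) := by
  have hx0 : 0 < x := by linarith
  have hlx : 0 < Real.log x := Real.log_pos hx
  have hz : ((1 / 3 : ℝ) : ℂ).re < 1 := by simp; norm_num
  rw [Fz_eq hz hx, Complex.add_re]
  -- main term
  have hmain : ((x : ℂ) ^ (((1 / 3 : ℝ) : ℂ) - 1) / ((1 - ((1 / 3 : ℝ) : ℂ)) * Real.log x)).re =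
      3 / (2 * x ^ (2 / 3 : ℝ) * Real.log x) := by
    rw [show (((1 / 3 : ℝ) : ℂ) - 1) = ((-(2 / 3) : ℝ) : ℂ) by push_cast; norm_num,
      ← Complex.ofReal_cpow hx0.le, show (1 - ((1 / 3 : ℝ) : ℂ)) = ((2 / 3 : ℝ) : ℂ) by push_cast; norm_num]
    rw [show ((x ^ (-(2 / 3) : ℝ) : ℝ) : ℂ) / (((2 / 3 : ℝ) : ℂ) * (Real.log x : ℂ)) =
      ((x ^ (-(2 / 3) : ℝ) / ((2 / 3) * Real.log x) : ℝ) : ℂ) by push_cast; ring, Complex.ofReal_re,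
      Real.rpow_neg hx0.le]
    field_simp
  rw [hmain]
  -- `r_{1/3} ≤ 0`: its integrand is `-(1/2) t^{-5/3}/log² t ≤ 0`
  have hr : (rz ((1 / 3 : ℝ) : ℂ) x).re ≤ 0 := by
    rw [rz]
    have hfun : ∀ t ∈ Ioi x, -((1 / 3 : ℝ) : ℂ) / (1 - ((1 / 3 : ℝ) : ℂ)) *
        ((t : ℂ) ^ (((1 / 3 : ℝ) : ℂ) - 2) * ((1 / Real.log t ^ 2 : ℝ) : ℂ)) =
        ((-(1 / 2) * (t ^ (-(5 / 3) : ℝ) * (1 / Real.log t ^ 2)) : ℝ) : ℂ) := by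
      intro t ht
      have ht0 : 0 ≤ t := by linarith [mem_Ioi.1 ht]
      rw [show (((1 / 3 : ℝ) : ℂ) - 2) = ((-(5 / 3) : ℝ) : ℂ) by push_cast; norm_num,
        ← Complex.ofReal_cpow ht0]
      push_cast
      ring
    rw [setIntegral_congr_fun measurableSet_Ioi hfun, integral_complex_ofReal, Complex.ofReal_re]
    refine setIntegral_nonpos measurableSet_Ioi fun t ht ↦ ?_
    have : 0 < Real.log t := Real.log_pos (hx.trans ht)
    have ht0 : 0 < t := hx0.trans ht
    have : 0 ≤ t ^ (-(5 / 3) : ℝ) * (1 / Real.log t ^ 2) := by positivity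
    nlinarith
  linarith

/-- **Nicolas 2012, (2.4)**: the two-sided bound for `F_{1/2}(x)`, `x > 1`:
`2/(√x log x) − 2/(√x log²x) ≤ F_{1/2}(x) ≤ 2/(√x log x) − 2/(√x log²x) + 8/(√x log³x)`.
[cite: Nicolas2012, Lemma 2.2 (2.4)] -/
theorem Fhalf_bounds (hx : 1 < x) :
    2 / (Real.sqrt x * Real.log x) - 2 / (Real.sqrt x * Real.log x ^ 2) ≤ (Fz (1 / 2 : ℝ) x).re ∧
      (Fz (1 / 2 : ℝ) x).re ≤ 2 / (Real.sqrt x * Real.log x) - 2 / (Real.sqrt x * Real.log x ^ 2) +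
        8 / (Real.sqrt x * Real.log x ^ 3) := by
  have hx0 : 0 < x := by linarith
  have hlx : 0 < Real.log x := Real.log_pos hx
  have hsx : 0 < Real.sqrt x := Real.sqrt_pos.2 hx0
  have hz : ((1 / 2 : ℝ) : ℂ).re < 1 := by simp; norm_num
  have hhalf : x ^ (-(1 / 2) : ℝ) = 1 / Real.sqrt x := by
    rw [Real.rpow_neg hx0.le, Real.sqrt_eq_rpow, inv_eq_one_div]
  -- the identity `F = main + r`, `r = -(1)(x^{-1/2}/((1/2) log² x) + ∫ 2/(-1/2) t^{-3/2}/log³ t)`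
  have hF := Fz_eq hz hx
  have hr := rz_eq hz hx
  -- the real integral `I₃ = ∫ t^{-3/2}/log³ t ∈ [0, 2/(√x log³ x)]`
  set I₃ : ℝ := ∫ t in Ioi x, t ^ (-(3 / 2) : ℝ) * (1 / Real.log t ^ 3) with hI₃
  have hI₃0 : 0 ≤ I₃ := setIntegral_nonneg measurableSet_Ioi fun t ht ↦ by
    have : 0 < Real.log t := Real.log_pos (hx.trans ht)
    have : 0 < t := hx0.trans ht
    positivity
  have hI₃le : I₃ ≤ 2 / (Real.sqrt x * Real.log x ^ 3) := by
    have hrpow : IntegrableOn (fun t : ℝ ↦ t ^ (-(3 / 2) : ℝ)) (Ioi x) :=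
      integrableOn_Ioi_rpow_of_lt (by norm_num) hx0
    calc I₃ ≤ ∫ t in Ioi x, 1 / Real.log x ^ 3 * t ^ (-(3 / 2) : ℝ) := by
          refine setIntegral_mono_on ?_ (hrpow.const_mul _) measurableSet_Ioi fun t ht ↦ ?_
          · -- integrability of `t^{-3/2}/log³ t`: dominated by `t^{-3/2}/log³ x`
            refine (hrpow.const_mul (1 / Real.log x ^ 3)).mono' ?_ ?_
            · refine ContinuousOn.aestronglyMeasurable ?_ measurableSet_Ioi
              refine ContinuousOn.mul (ContinuousOn.rpow_const continuousOn_id fun t ht ↦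
                Or.inl (by linarith [mem_Ioi.1 ht] : (t : ℝ) ≠ 0)) ?_
              exact (continuousOn_inv_log_pow hx 3).mono Ioi_subset_Ici_self
            · refine (ae_restrict_iff' measurableSet_Ioi).2 (ae_of_all _ fun t ht ↦ ?_)
              have ht0 : 0 < t := hx0.trans ht
              have h := inv_log_pow_le hx 3 ht.le
              rw [Real.norm_eq_abs, abs_mul, abs_of_pos (Real.rpow_pos_of_pos ht0 _), mul_comm]
              exact mul_le_mul_of_nonneg_right h (by positivity)
          have h := inv_log_pow_le hx 3 ht.le
          have ht0 : 0 < t := hx0.trans ht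
          rw [abs_of_nonneg (by have : 0 < Real.log t := Real.log_pos (hx.trans ht); positivity)] at h
          rw [mul_comm]
          exact mul_le_mul_of_nonneg_right h (by positivity)
      _ = 1 / Real.log x ^ 3 * (-x ^ (-(3 / 2) + 1 : ℝ) / (-(3 / 2) + 1)) := by
          rw [integral_const_mul, integral_Ioi_rpow_of_lt (by norm_num) hx0]
      _ = 2 / (Real.sqrt x * Real.log x ^ 3) := by
          rw [show (-(3 / 2) + 1 : ℝ) = -(1 / 2) by norm_num, hhalf]
          field_simp
  -- real parts of the pieces
  have hmain : ((x : ℂ) ^ (((1 / 2 : ℝ) : ℂ) - 1) / ((1 - ((1 / 2 : ℝ) : ℂ)) * Real.log x)).re =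
      2 / (Real.sqrt x * Real.log x) := by
    rw [show (((1 / 2 : ℝ) : ℂ) - 1) = ((-(1 / 2) : ℝ) : ℂ) by push_cast; norm_num,
      ← Complex.ofReal_cpow hx0.le, show (1 - ((1 / 2 : ℝ) : ℂ)) = ((1 / 2 : ℝ) : ℂ) by push_cast; norm_num,
      show ((x ^ (-(1 / 2) : ℝ) : ℝ) : ℂ) / (((1 / 2 : ℝ) : ℂ) * (Real.log x : ℂ)) =
        ((x ^ (-(1 / 2) : ℝ) / ((1 / 2) * Real.log x) : ℝ) : ℂ) by push_cast; ring, Complex.ofReal_re, hhalf]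
    field_simp
  have hrre : (rz ((1 / 2 : ℝ) : ℂ) x).re = -(2 / (Real.sqrt x * Real.log x ^ 2)) + 4 * I₃ := by
    rw [hr]
    have e1 : ((1 / 2 : ℝ) : ℂ) / (1 - ((1 / 2 : ℝ) : ℂ)) = 1 := by push_cast; norm_num
    have e2 : ((x : ℂ) ^ (((1 / 2 : ℝ) : ℂ) - 1) / ((1 - ((1 / 2 : ℝ) : ℂ)) * (Real.log x : ℂ) ^ 2)) =
        ((2 / (Real.sqrt x * Real.log x ^ 2) : ℝ) : ℂ) := by
      rw [show (((1 / 2 : ℝ) : ℂ) - 1) = ((-(1 / 2) : ℝ) : ℂ) by push_cast; norm_num,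
        ← Complex.ofReal_cpow hx0.le, hhalf, show (1 - ((1 / 2 : ℝ) : ℂ)) = ((1 / 2 : ℝ) : ℂ) by
          push_cast; norm_num]
      push_cast
      field_simp
    have e3 : (∫ t in Ioi x, 2 / (((1 / 2 : ℝ) : ℂ) - 1) *
        ((t : ℂ) ^ (((1 / 2 : ℝ) : ℂ) - 2) * ((1 / Real.log t ^ 3 : ℝ) : ℂ))) = ((-4 * I₃ : ℝ) : ℂ) := by
      rw [hI₃, ← integral_const_mul, ← integral_complex_ofReal]
      refine setIntegral_congr_fun measurableSet_Ioi fun t ht ↦ ?_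
      have ht0 : 0 ≤ t := by linarith [mem_Ioi.1 ht]
      rw [show (((1 / 2 : ℝ) : ℂ) - 2) = ((-(3 / 2) : ℝ) : ℂ) by push_cast; norm_num,
        ← Complex.ofReal_cpow ht0, show (2 / (((1 / 2 : ℝ) : ℂ) - 1)) = ((-4 : ℝ) : ℂ) by
          push_cast; norm_num]
      push_cast
      ring
    rw [e1, e2, e3]
    have : (-(1 : ℂ) * ((((2 / (Real.sqrt x * Real.log x ^ 2)) : ℝ) : ℂ) + ((-4 * I₃ : ℝ) : ℂ))) =
        (((-(2 / (Real.sqrt x * Real.log x ^ 2)) + 4 * I₃ : ℝ)) : ℂ) := by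
      push_cast; ring
    rw [this, Complex.ofReal_re]
  rw [hF, Complex.add_re, hmain, hrre]
  have h8 : 4 * I₃ ≤ 8 / (Real.sqrt x * Real.log x ^ 3) := by
    calc 4 * I₃ ≤ 4 * (2 / (Real.sqrt x * Real.log x ^ 3)) := by linarith
      _ = 8 / (Real.sqrt x * Real.log x ^ 3) := by ring
  constructor <;> linarith

/-- **Nicolas 2012, (2.4), upper half** (the half used in the lower bound for `log f`):
`F_{1/2}(x) ≤ 2/(√x log x) − 2/(√x log² x) + 8/(√x log³ x)`. [cite: Nicolas2012, Lemma 2.2 (2.4)] -/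
theorem Fhalf_le (hx : 1 < x) :
    (Fz (1 / 2 : ℝ) x).re ≤ 2 / (Real.sqrt x * Real.log x) - 2 / (Real.sqrt x * Real.log x ^ 2) +
      8 / (Real.sqrt x * Real.log x ^ 3) :=
  (Fhalf_bounds hx).2

/-- **Nicolas 2012, (2.4), lower half**: `2/(√x log x) − 2/(√x log² x) ≤ F_{1/2}(x)`.
[cite: Nicolas2012, Lemma 2.2 (2.4)] -/
theorem Fhalf_ge (hx : 1 < x) :
    2 / (Real.sqrt x * Real.log x) - 2 / (Real.sqrt x * Real.log x ^ 2) ≤ (Fz (1 / 2 : ℝ) x).re :=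
  (Fhalf_bounds hx).1

end NicolasFz

end Literature.NumberTheory.LFunctions

end
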